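import Literature.Geometry.Lorentzian.KerrFarCurrentIdentity
import Literature.Geometry.Lorentzian.KerrLargeRCurrent
import Literature.Geometry.Lorentzian.KerrLargeRWeight
import HarnessLib

/-!
# The Dafermos–Rodnianski large-`r` (Morawetz) current of subextremal Kerr in the far region:
# regularity of the multiplier and coercivity of the bulk

(family `gr`; the Morawetz step (Moschidis, arXiv:1509.08489, Lemma 4.1; DRSR, arXiv:1402.7034,
Prop. 4.6.1) toward statement **gr.S24**; namespace `Literature.Geometry.Lorentzian.Kerr`)

The Dafermos–Rodnianski large-`r` current is the modified current `J^X + ¼ L_ϖ` of the multiplier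
`X_δ = (1 − |x⃗|^{−δ}) ∂_ρ` (`X⁰ = 0`, `Xⁱ = (|x⃗|^{−1} − |x⃗|^{−1−δ}) xⁱ`) and the weight
`ϖ_δ = 4(|x⃗|^{−1} − |x⃗|^{−1−δ} + (δ/2)|x⃗|^{−1−2δ})` (`KerrLargeRCurrent.lean`,
`KerrLargeRWeight.lean`, where both are written as explicit functions of `|x⃗|²`). This file:

* `Kerr.contDiffAt_largeRMultiplier`: the components of `X_δ` are smooth off the time axis;
* the identity for `X = X_δ`, `ϖ = ϖ_δ` is `Kerr.far_cutoffCurrent_identity` fed with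
  `Kerr.contDiffAt_largeRMultiplier` and `KerrSchild.contDiffAt_largeRWeight` (two lines; not
  restated);
* `Kerr.largeR_bulk_coercive` (**proved**): at a point of the exterior with Kerr radius
  `r ≥ max(2^{1/δ}, |a|)` and `δ r^{1−δ} ≥ 1042432 M`, the bulk of the identity dominates
  `(δ/32) r^{−1−δ} ∑_μ (∂_μψ̃)² + (δ/128) r^{−3−δ} ψ̃²`
  (`KerrSchild.kerr_largeR_firstOrder_coercive` + `KerrSchild.kerr_largeR_zerothOrder_coercive`).

No definitions, no named facts (D-0026).

## References

* M. Dafermos, I. Rodnianski, arXiv:1010.5132, §6 (key `DafermosRodnianski2010`).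
* M. Dafermos, I. Rodnianski, Y. Shlapentokh-Rothman, arXiv:1402.7034, §4.6, Prop. 4.6.1
  (key `DafermosRodnianskiShlapentokhrothman2014`).
* G. Moschidis, arXiv:1509.08489, Lemma 4.1 (key `Moschidis2016`).
-/

noncomputable section

open Bundle Set TopologicalSpace Filter MeasureTheory Metric
open scoped Manifold ContDiff Topology ENNReal

namespace Literature.Geometry.Lorentzian

namespace Kerr

/-- **The DR multiplier is smooth off the time axis**: each component
`X^α(y) = [α ≠ 0] ((|y⃗|²)^{−1/2} − (|y⃗|²)^{−(1+δ)/2}) y^α` is `C^n` at every `x` with `|x⃗| > 0`.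
[folklore] -/
theorem contDiffAt_largeRMultiplier (δ : ℝ) {x : E4} (hx : 0 < E4.spatialNorm x) (α : Fin 4)
    {n : WithTop ℕ∞} :
    ContDiffAt ℝ n (fun y : E4 ↦ (if α = 0 then (0 : ℝ) else
      ((E4.spatialNorm y ^ 2) ^ (-(1 / 2 : ℝ)) - (E4.spatialNorm y ^ 2) ^ (-(1 + δ) / 2)) * y α)) x := by
  by_cases hα : α = 0
  · simp only [hα, if_true]; exact contDiffAt_const
  · simp only [hα, if_false]
    have hs : 0 < E4.spatialNorm x ^ 2 := by positivity
    have h := fun b : ℝ ↦ (Real.contDiffAt_rpow_const_of_ne (p := b) (n := n) hs.ne').comp x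
      (Kerr.contDiff_spatialNorm_sq.contDiffAt)
    exact ((h _).sub (h _)).mul (E4.dx α).contDiff.contDiffAt

variable [Facts] [SliceFacts]

omit [Facts] [SliceFacts] in
/-- **Coercivity of the bulk of the DR large-`r` current on Kerr**: at a point with Kerr radius
`r ≥ 2^{1/δ}`, `r ≥ |a|`, `δ r^{1−δ} ≥ 1042432 M` (`0 < δ ≤ 1`, `M ≥ 0`), for every `w`,
`(δ/32) r^{−1−δ} ∑_μ (∂_μw)² + (δ/128) r^{−3−δ} w² ≤ K^{X_δ}[w] + ¼ ϖ_δ G(dw,dw) − ⅛ (□ϖ_δ) w²`.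
[cite: DafermosRodnianskiShlapentokhrothman2014, §4.6, Prop. 4.6.1] -/
theorem largeR_bulk_coercive {δ M a : ℝ} (hδ0 : 0 < δ) (hδ1 : δ ≤ 1) (hM : 0 ≤ M)
    (w : E4 → ℝ) {x : E4} (hx : (2 : ℝ) ^ (1 / δ) ≤ radius a x) (hax : |a| ≤ radius a x)
    (hlarge : 1042432 * M ≤ δ * radius a x ^ (1 - δ)) :
    δ / 32 * radius a x ^ (-1 - δ) * ∑ μ, fderiv ℝ w x (E4.basisVector μ) ^ 2 +
        δ / 128 * radius a x ^ (-3 - δ) * w x ^ 2 ≤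
      KerrSchild.multiplierBulk (inverseMetric M a)
          (fun (y : E4) (α : Fin 4) ↦ if α = 0 then (0 : ℝ) else
            ((E4.spatialNorm y ^ 2) ^ (-(1 / 2 : ℝ)) - (E4.spatialNorm y ^ 2) ^ (-(1 + δ) / 2)) * y α) w x +
        4⁻¹ * ((fun y : E4 ↦ 4 * ((E4.spatialNorm y ^ 2) ^ (-(1 / 2 : ℝ)) -
          (E4.spatialNorm y ^ 2) ^ (-((1 + δ) / 2)) + δ / 2 * (E4.spatialNorm y ^ 2) ^ (-((1 + 2 * δ) / 2)))) x *
          ∑ α, ∑ β, inverseMetric M a x α β * fderiv ℝ w x (E4.basisVector α) *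
            fderiv ℝ w x (E4.basisVector β)) -
        8⁻¹ * KerrSchild.waveOperator (inverseMetric M a) (fun y : E4 ↦ 4 * ((E4.spatialNorm y ^ 2) ^ (-(1 / 2 : ℝ)) -
          (E4.spatialNorm y ^ 2) ^ (-((1 + δ) / 2)) + δ / 2 * (E4.spatialNorm y ^ 2) ^ (-((1 + 2 * δ) / 2)))) x *
          w x ^ 2 := by
  have h1 := KerrSchild.kerr_largeR_firstOrder_coercive hδ0 hδ1 hM w hx hax (by linarith)
  have h2 := KerrSchild.kerr_largeR_zerothOrder_coercive (a := a) hδ0 hδ1 hM hx hax hlarge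
  have h2' := mul_le_mul_of_nonneg_right h2 (sq_nonneg (w x))
  have e : -8⁻¹ * KerrSchild.waveOperator (inverseMetric M a) (fun y : E4 ↦ 4 * ((E4.spatialNorm y ^ 2) ^ (-(1 / 2 : ℝ)) -
      (E4.spatialNorm y ^ 2) ^ (-((1 + δ) / 2)) + δ / 2 * (E4.spatialNorm y ^ 2) ^ (-((1 + 2 * δ) / 2)))) x *
      w x ^ 2 = -(8⁻¹ * KerrSchild.waveOperator (inverseMetric M a) (fun y : E4 ↦ 4 * ((E4.spatialNorm y ^ 2) ^ (-(1 / 2 : ℝ)) -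
      (E4.spatialNorm y ^ 2) ^ (-((1 + δ) / 2)) + δ / 2 * (E4.spatialNorm y ^ 2) ^ (-((1 + 2 * δ) / 2)))) x *
      w x ^ 2) := by ring
  simp only at h1
  linarith [h1, h2', e]

end Kerr

end Literature.Geometry.Lorentzian
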